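import Mathlib

/-!
# Weighted components under weight-compatible substitutions

Route `ValiantsHypothesis/BorderApolarity`, crux `ToricWitnessObstructionQP`
(stmt-ValiantsHypothesis-14753), line `Sketch`, lead c5 — preparatory file for the BRIDGE from
extremal toric representations of the padded permanent (the objects of the line's landed
normal-form chain) to the jet-regime theorem `jetRegime_seven_le` (crux work note
`RegimesPer3BelowGrenet.md`, §3): the two specialisations "unused variables ↦ 0" and "x₀₀ ↦ 1"
are substitutions `aa` each of whose values `aa v` is weighted homogeneous of the weight of `v`,
and such substitutions commute with taking weighted homogeneous components.

* `IsWeightedHomogeneous.aeval_of_forall`: if `aa v` is `w₂`-weighted homogeneous of weight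
  `w₁ v` for every `v`, then `aeval aa` maps `w₁`-weighted homogeneous polynomials of weight `j` to
  `w₂`-weighted homogeneous polynomials of weight `j`;
* `weightedHomogeneousComponent_aeval`: `in^{w₂}_j (aeval aa Φ) = aeval aa (in^{w₁}_j Φ)`;
* `weight_le_of_mem_support_aeval`: weights of the monomials of `aeval aa Φ` are weights of
  monomials of `Φ`;
* `weightedHomogeneousComponent_comm`: components for two weights commute;
* `weightedHomogeneousComponent_eq_of_shift`: on a polynomial all of whose monomials satisfy
  `w₂ = w₁ + c`, the components agree up to the shift.
-/

open MvPolynomial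

-- the mandated summit-side namespace repeats a component by design (single-problem summit)
set_option linter.dupNamespace false

namespace Summit.ValiantsHypothesis.ValiantsHypothesis.Theorems.BorderApolarityToricWitnessObstructionQP

noncomputable section

namespace WeightedSubst

variable {R : Type*} [CommRing R] {σ₁ σ₂ : Type*}

/-- **Weight-compatible substitutions preserve weighted homogeneity.** [folklore] -/
theorem IsWeightedHomogeneous.aeval_of_forall (w₁ : σ₁ → ℕ) (w₂ : σ₂ → ℕ)
    (aa : σ₁ → MvPolynomial σ₂ R) (haa : ∀ v, IsWeightedHomogeneous w₂ (aa v) (w₁ v))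
    {Φ : MvPolynomial σ₁ R} {j : ℕ} (hΦ : IsWeightedHomogeneous w₁ Φ j) :
    IsWeightedHomogeneous w₂ (aeval aa Φ) j := by
  classical
  rw [Φ.as_sum, map_sum]
  refine IsWeightedHomogeneous.sum _ _ _ fun d hd => ?_
  have hwd : Finsupp.weight w₁ d = j := hΦ (mem_support_iff.1 hd)
  rw [aeval_monomial, ← hwd]
  have hprod : IsWeightedHomogeneous w₂ (d.prod fun v k => aa v ^ k)
      (∑ v ∈ d.support, d v • w₁ v) := by
    unfold Finsupp.prod
    refine IsWeightedHomogeneous.prod _ _ _ fun v _ => ?_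
    exact (haa v).pow (d v)
  have hw : (∑ v ∈ d.support, d v • w₁ v) = Finsupp.weight w₁ d := by
    rw [Finsupp.weight_apply, Finsupp.sum]
  rw [hw] at hprod
  rw [← zero_add (Finsupp.weight w₁ d)]
  exact (isWeightedHomogeneous_C w₂ _).mul hprod

/-- A finite-sum decomposition into weighted components over any range containing the weights. -/
theorem sum_weightedHomogeneousComponent_range (w : σ₁ → ℕ) (Φ : MvPolynomial σ₁ R) (N : ℕ)
    (hN : ∀ d ∈ Φ.support, Finsupp.weight w d ≤ N) :
    ∑ j ∈ Finset.range (N + 1), weightedHomogeneousComponent w j Φ = Φ := by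
  classical
  have h := sum_weightedHomogeneousComponent w Φ
  rw [finsum_eq_sum_of_support_subset _ (s := Finset.range (N + 1))] at h
  · exact h
  · intro j hj
    rw [Function.mem_support] at hj
    rw [Finset.coe_range, Set.mem_Iio, Nat.lt_succ_iff]
    by_contra hjN
    exact hj (weightedHomogeneousComponent_eq_zero' j Φ fun d hd => by
      have := hN d hd; omega)

/-- **Weighted components commute with weight-compatible substitutions.** [folklore] -/
theorem weightedHomogeneousComponent_aeval (w₁ : σ₁ → ℕ) (w₂ : σ₂ → ℕ)
    (aa : σ₁ → MvPolynomial σ₂ R) (haa : ∀ v, IsWeightedHomogeneous w₂ (aa v) (w₁ v))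
    (Φ : MvPolynomial σ₁ R) (j : ℕ) :
    weightedHomogeneousComponent w₂ j (aeval aa Φ) = aeval aa (weightedHomogeneousComponent w₁ j Φ) := by
  classical
  -- decompose `Φ` over a range containing all its weights and `j`
  set N : ℕ := (Φ.support.sup fun d => Finsupp.weight w₁ d) + j with hN
  have hle : ∀ d ∈ Φ.support, Finsupp.weight w₁ d ≤ N := fun d hd =>
    (Finset.le_sup (f := fun d => Finsupp.weight w₁ d) hd).trans (Nat.le_add_right _ _)
  conv_lhs => rw [← sum_weightedHomogeneousComponent_range w₁ Φ N hle, map_sum, map_sum]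
  rw [Finset.sum_eq_single j]
  · exact (IsWeightedHomogeneous.aeval_of_forall w₁ w₂ aa haa
      (weightedHomogeneousComponent_isWeightedHomogeneous (w := w₁) j Φ)).weightedHomogeneousComponent_same
  · intro j' _ hj'
    exact (IsWeightedHomogeneous.aeval_of_forall w₁ w₂ aa haa
      (weightedHomogeneousComponent_isWeightedHomogeneous (w := w₁) j' Φ)).weightedHomogeneousComponent_ne j
        (Ne.symm hj')
  · intro hj
    exfalso
    exact hj (Finset.mem_range.2 (by omega))

/-- Weights of the monomials of `aeval aa Φ` are weights of monomials of `Φ` (for a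
weight-compatible substitution): an upper bound transfers. [folklore] -/
theorem weight_le_of_mem_support_aeval (w₁ : σ₁ → ℕ) (w₂ : σ₂ → ℕ)
    (aa : σ₁ → MvPolynomial σ₂ R) (haa : ∀ v, IsWeightedHomogeneous w₂ (aa v) (w₁ v))
    (Φ : MvPolynomial σ₁ R) (N : ℕ) (hN : ∀ d ∈ Φ.support, Finsupp.weight w₁ d ≤ N) :
    ∀ d ∈ (aeval aa Φ).support, Finsupp.weight w₂ d ≤ N := by
  classical
  intro d hd
  rw [← sum_weightedHomogeneousComponent_range w₁ Φ N hN, map_sum, mem_support_iff, coeff_sum] at hd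
  obtain ⟨j, hj, hjd⟩ := Finset.exists_ne_zero_of_sum_ne_zero hd
  have hhom := IsWeightedHomogeneous.aeval_of_forall w₁ w₂ aa haa
    (weightedHomogeneousComponent_isWeightedHomogeneous (w := w₁) j Φ)
  rw [hhom hjd]
  exact Nat.lt_succ_iff.1 (Finset.mem_range.1 hj)

/-- Weighted components for two weights commute. [folklore] -/
theorem weightedHomogeneousComponent_comm (w₁ w₂ : σ₁ → ℕ) (a b : ℕ) (Φ : MvPolynomial σ₁ R) :
    weightedHomogeneousComponent w₁ a (weightedHomogeneousComponent w₂ b Φ) =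
      weightedHomogeneousComponent w₂ b (weightedHomogeneousComponent w₁ a Φ) := by
  classical
  ext d
  simp only [coeff_weightedHomogeneousComponent]
  split_ifs <;> rfl

/-- If on the support of `Φ` the weight `w₂` is the weight `w₁` shifted by `c`, the components
agree up to the shift. [folklore] -/
theorem weightedHomogeneousComponent_eq_of_shift (w₁ w₂ : σ₁ → ℕ) (c : ℕ) (Φ : MvPolynomial σ₁ R)
    (h : ∀ d ∈ Φ.support, Finsupp.weight w₂ d = Finsupp.weight w₁ d + c) (j : ℕ) :
    weightedHomogeneousComponent w₁ j Φ = weightedHomogeneousComponent w₂ (j + c) Φ := by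
  classical
  ext d
  simp only [coeff_weightedHomogeneousComponent]
  by_cases hd : d ∈ Φ.support
  · rw [h d hd]
    by_cases hj : Finsupp.weight w₁ d = j
    · rw [if_pos hj, if_pos (by rw [hj])]
    · rw [if_neg hj, if_neg (by omega)]
  · rw [notMem_support_iff] at hd
    rw [hd]
    split_ifs <;> rfl

end WeightedSubst

/-- **Weighted components commute with weight-compatible substitutions** (registered helper form
of `WeightedSubst.weightedHomogeneousComponent_aeval`). [folklore] -/
theorem weightedSubst_component_aeval : ∀ {R : Type*} [CommRing R] {σ₁ σ₂ : Type*} (w₁ : σ₁ → ℕ) (w₂ : σ₂ → ℕ) (aa : σ₁ → MvPolynomial σ₂ R), (∀ v, MvPolynomial.IsWeightedHomogeneous w₂ (aa v) (w₁ v)) → ∀ (Φ : MvPolynomial σ₁ R) (j : ℕ), MvPolynomial.weightedHomogeneousComponent w₂ j (MvPolynomial.aeval aa Φ) = MvPolynomial.aeval aa (MvPolynomial.weightedHomogeneousComponent w₁ j Φ) :=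
  fun w₁ w₂ aa haa Φ j => WeightedSubst.weightedHomogeneousComponent_aeval w₁ w₂ aa haa Φ j

end

end Summit.ValiantsHypothesis.ValiantsHypothesis.Theorems.BorderApolarityToricWitnessObstructionQP
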